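import Summits.BirchSwinnertonDyer.BirchSwinnertonDyer.Theorems.PrintCf2RubinValueTwoKatzPeriodRigidityLines
import Literature.NumberTheory.EllipticCurves.IntSeriesBinomialSeriesComposition
import Literature.NumberTheory.LocalFields.BinomialTwistExponentDenseValued
import HarnessLib

set_option linter.dupNamespace false
set_option autoImplicit false

/-!
# FULL TWO-VARIABLE KATZ PERIOD RIGIDITY (every prime `p`): two frames of ONE branch at two period triples differ by a
# UNIT of `𝒪_{ℂ_p}⟦T₁⟧⟦T₂⟧` — `G' = C₀·(1+T₁)^x·(1+T₂)^w·G`, `x, w ∈ ℤ_p`, `C₀ = A^{a+b}B^b ∈ 𝒪_{ℂ_p}^×` — hence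
# `(G') = (G)`: the characteristic-ideal clause of the two-variable main conjecture does not depend on the period triple

Cell `bsd-print-cf2`, width seat `bsd-line-cf2c-w3` g5, route C `PrintCf2RubinValueTwo`, `--supports stmt-BirchSwinnertonDyer-23722`
(the «(R) period-rigidity» aside; load-bearing for the ∀(Ω,δ,Ω_p,G₂)-form of the DECIDING child `MainConjClauseAtSplitTwoQuad`,
stmt-24086, which it reduces to ONE admissible period triple and ONE Katz measure).  Theses-free; THEOREMS ONLY (no `def`, no named
fact, no `sorry`); nothing is closed; BSD is not proved by any of this; no summit statement is proved by this seat.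

PROOF (exp/log-free).  `KatzPeriodRigidityLines.exists_lineTwists_affine`: on every supply line `s` (directions
`e(s) = p(s+s₀+1)·d − d′`, `d₁d₂′ ≠ d₂d₁′`), `G'|_s = C₀·(1+T)^{ε + s·δ}·G|_s`.  Solve the 2×2 system for RATIONAL exponents
`(x, w) ∈ ℚ_p²` with `x·e₁(s) + w·e₂(s) = ε + sδ` for all `s` (Cramer; `p` and `Δ = d₁d₂′ − d₂d₁′` are invertible in `ℚ_p`), and
work FORMALLY in `ℂ_p⟦T₁⟧⟦T₂⟧` with Mathlib's binomial series `B(y, T)` (`y ∈ ℂ_p`): the series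
`H = G' − C₀·B(x,T₁)B(w,T₂)·G` restricts to `0` along every supply line (`IntSeries.curveSubst_mul` + the formal composition law
`IntSeries.curveSubst_binomialSeries₂`: `B(x,T₁)B(w,T₂)|_{(c₁,c₂)} = B(xc₁ + wc₂, T)`), hence `H = 0` by the tangent-cone identity
principle `IntSeries.eq_zero_of_curveSubst_eq_zero` over the domain `ℂ_p`.  INTEGRALITY: restricting `H = 0` to the lines `(1, k)` gives
`G'|_{(1,k)} = C₀·B(x + kw, T)·G|_{(1,k)}` with BOTH sides' series integral, so `x + kw ∈ ℤ_p` whenever `G|_{(1,k)} ≠ 0`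
(`LocalFields.exists_padicInt_eq_of_binomial_twist_of_ne_zero`, the unit-content-free exponent integrality, p703177); all but finitely
many `k` qualify, two consecutive ones give `x, w ∈ ℤ_p`, and then `B(x,T₁)B(w,T₂) = (1+T₁)^x(1+T₂)^w ∈ 𝒪_{ℂ_p}⟦T₁⟧⟦T₂⟧^×`.

* **`exists_eq_unit_binomPow₂_mul`** — THE THEOREM (B18 binder list; `G ≠ 0`; six non-zero periods).
* **`span_eq_span_of_isKatzMeasure₂`** — `Ideal.span {G'} = Ideal.span {G}`.
* **`charIdeal_clause_transport`** — for any ideal `I` of `𝒪_{ℂ_p}⟦T₁⟧⟦T₂⟧`: `I = span {G} ↔ I = span {G'}` (the shape in which the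
  main-conjecture clause `(char X).map J = span {G₂}` is keyed).

References: [deShalit1987] II.4.12 Remarks (iii)–(iv) (p. 66–67), II.4.16 (49)–(50), II.4.17 (52)–(54) (p. 77–78); [Gouvea1993PadicNumbers]
§5.9 Lemma 5.9.1, Problem 194; [Robert2000PadicAnalysis] V.2.4, VI.2.1; [Washington1997] §13.
-/

noncomputable section

open scoped NumberField Classical Topology
open Filter NumberField IsDedekindDomain Field Finset
open Literature Literature.NumberTheory.GaloisRepresentations Literature.NumberTheory.EllipticCurves
open Literature.NumberTheory.LocalFields
open Summit.BirchSwinnertonDyer.Rank1Residual.X11b Summit.BirchSwinnertonDyer.BirchSwinnertonDyer.Theorems.PrintCf2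

namespace Summit.BirchSwinnertonDyer.BirchSwinnertonDyer.Theorems.PrintCf2.KatzPeriodRigidity

variable {p : ℕ} [Fact p.Prime] {K : Type} [Field K] [NumberField K]

/-- The lines `(1, k)` along which `G` vanishes are finitely many (for `G ≠ 0`).
[cite: deShalit1987, II.4.17 (52)–(54) (p. 77–78)] [cite: Washington1997, §13] -/
theorem finite_setOf_monomialLine_one_eq_zero {G : PowerSeries (PowerSeries (PadicComplexInt p))} (hG0 : G ≠ 0) :
    {k : ℕ | IntSeries.monomialLine (1 : ℤ_[p]) ((k + 1 : ℕ) : ℤ_[p]) G = 0}.Finite := by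
  by_contra hinf
  apply hG0
  set φ := Set.Infinite.natEmbedding _ (Set.not_finite.1 hinf) with hφ
  refine IntSeries.eq_zero_of_monomialLine_eq_zero G (fun _ ↦ (1 : ℤ_[p])) (fun n ↦ (((φ n).1 + 1 : ℕ) : ℤ_[p]))
    (fun n ↦ by exact_mod_cast Nat.succ_ne_zero (φ n).1) (fun n n' hnn' h ↦ hnn' (φ.injective (Subtype.ext ?_)))
    fun n ↦ (φ n).2
  rw [one_mul, one_mul] at h
  have h' : ((φ n').1 + 1 : ℕ) = ((φ n).1 + 1 : ℕ) := by exact_mod_cast h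
  omega

/-- **FULL TWO-VARIABLE KATZ PERIOD RIGIDITY.** On B18's binder list (`K` imaginary quadratic with a type-`(w₀,0)` character, `p = v v̄`,
`ι ↔ v`, twist `λ` of type `(−a, b)`, `b ≤ a`, unramified off `S ∪ {v̄}`, any generator pair): if `G ≠ 0` solves de Shalit's frame
at `(Ω, δ, Ω_p)` and `G'` solves the frame of the SAME branch at `(Ω', δ', Ω_p')` (six non-zero period quantities), then
`G' = C₀·(1+T₁)^x·(1+T₂)^w·G` in `𝒪_{ℂ_p}⟦T₁⟧⟦T₂⟧` for some `x, w ∈ ℤ_p` and the UNIT `C₀ = A^{a+b}B^b` of `𝒪_{ℂ_p}`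
(`A = ι⁻¹(Ω/Ω')·Ω_p'/Ω_p`, `B = ι⁻¹(δ/δ')`). [cite: deShalit1987, II.4.12 Remarks (iii)–(iv) (p. 66–67), II.4.17 (52)–(54) (p. 77–78)]
[cite: Gouvea1993PadicNumbers, §5.9 Lemma 5.9.1 and Problem 194] -/
theorem exists_eq_unit_binomPow₂_mul (hK : IsImaginaryQuadratic K)
    {ι : PadicAlgCl p ≃+* ℂ} {v vbar : HeightOneSpectrum (𝓞 K)}
    (hv : ((p : ℕ) : 𝓞 K) ∈ v.asIdeal) (hvbar : ((p : ℕ) : 𝓞 K) ∈ vbar.asIdeal) (hne : vbar ≠ v)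
    (hι : ∀ (w : InfinitePlace K) (d : 𝓞 K), d ∈ v.asIdeal ↔ ‖ι.symm (w.embedding (d : K))‖ < 1)
    {S : Finset (HeightOneSpectrum (𝓞 K))}
    {η : HeckeCharacter K} {w₀ : ℕ} (hw₀ : 0 < w₀) (hη : η.HasInfinityType (fun _ ↦ (w₀ : ℤ)) (fun _ ↦ 0))
    {lam : HeckeCharacter K} {a b : ℕ} (hba : b ≤ a)
    (hlam : lam.HasInfinityType (fun _ ↦ -(a : ℤ)) (fun _ ↦ (b : ℤ)))
    (hlamu : ∀ w : HeightOneSpectrum (𝓞 K), w ∉ S → w ≠ vbar → lam.IsUnramifiedAt w)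
    {κ₁ κ₂ : ZpExtension K p} {γ₁ γ₂ : absoluteGaloisGroup K}
    (hpair : ZpExtension.IsTopGeneratorPair κ₁ κ₂ γ₁ γ₂)
    {Ω δ Ω' δ' : ℂ} {Ωp Ωp' : ℂ_[p]} {G G' : PowerSeries (PowerSeries (PadicComplexInt p))}
    (hG : IsKatzMeasure₂ ι v vbar S κ₁ κ₂ γ₁ γ₂ lam Ω δ Ωp G)
    (hG' : IsKatzMeasure₂ ι v vbar S κ₁ κ₂ γ₁ γ₂ lam Ω' δ' Ωp' G')
    (hΩ : Ω ≠ 0) (hδ : δ ≠ 0) (hΩp : Ωp ≠ 0) (hΩ' : Ω' ≠ 0) (hδ' : δ' ≠ 0) (hΩp' : Ωp' ≠ 0)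
    (hG0 : G ≠ 0) :
    ∃ (c₀ : PadicComplexInt p) (x w : ℤ_[p]), IsUnit c₀ ∧
      (c₀ : ℂ_[p]) = ((((ι.symm (Ω / Ω')) : PadicAlgCl p) : ℂ_[p]) * (Ωp' / Ωp)) ^ (a + b) *
        (((ι.symm (δ / δ')) : PadicAlgCl p) : ℂ_[p]) ^ b ∧
      G' = PowerSeries.C (PowerSeries.C c₀) *
        (PowerSeries.map (PowerSeries.C (R := PadicComplexInt p)) (IntSeries.binomPow x) * PowerSeries.C (IntSeries.binomPow w)) * G := by
  have hp : p.Prime := Fact.out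
  obtain ⟨e₁, e₂, d₁, d₂, d₁', d₂', s₀, c₀, ε, dz, hdet, he₁, he₂, hc₂, hprop, hc₀unit, hc₀val, hlines⟩ :=
    exists_lineTwists_affine hK hv hvbar hne hι hw₀ hη hba hlam hlamu hpair hG hG' hΩ hδ hΩp hΩ' hδ' hΩp' hG0
  -- §A the rational exponents
  set Δ : ℚ_[p] := (d₁ : ℚ_[p]) * d₂' - d₂ * d₁' with hΔ
  have hΔ0 : Δ ≠ 0 := by
    rw [hΔ]
    intro h
    apply hdet
    have h' : ((d₁ * d₂' : ℤ_[p]) : ℚ_[p]) = ((d₂ * d₁' : ℤ_[p]) : ℚ_[p]) := by push_cast; linear_combination h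
    exact Subtype.coe_injective h'
  have hp0 : (p : ℚ_[p]) ≠ 0 := by exact_mod_cast hp.ne_zero
  set X₀ : ℚ_[p] := (dz : ℚ_[p]) / p with hX₀
  set Y₀ : ℚ_[p] := ((s₀ : ℚ_[p]) + 1) * dz - ε with hY₀
  set xq : ℚ_[p] := (X₀ * d₂' - d₂ * Y₀) / Δ with hxq
  set wq : ℚ_[p] := (d₁ * Y₀ - X₀ * d₁') / Δ with hwq
  have hX : xq * d₁ + wq * d₂ = X₀ := by
    rw [hxq, hwq]
    field_simp
    rw [hΔ]
    ring
  have hY : xq * d₁' + wq * d₂' = Y₀ := by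
    rw [hxq, hwq]
    field_simp
    rw [hΔ]
    ring
  have hexp : ∀ s : ℕ, xq * (e₁ s : ℚ_[p]) + wq * (e₂ s : ℚ_[p]) = ((ε + (s : ℤ_[p]) * dz : ℤ_[p]) : ℚ_[p]) := by
    intro s
    calc xq * (e₁ s : ℚ_[p]) + wq * (e₂ s : ℚ_[p])
        = ((p * (s + s₀ + 1) : ℕ) : ℚ_[p]) * (xq * d₁ + wq * d₂) - (xq * d₁' + wq * d₂') := by
          rw [he₁ s, he₂ s]; push_cast; ring
      _ = ((p * (s + s₀ + 1) : ℕ) : ℚ_[p]) * X₀ - Y₀ := by rw [hX, hY]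
      _ = ((ε + (s : ℤ_[p]) * dz : ℤ_[p]) : ℚ_[p]) := by
          rw [hX₀, hY₀]; push_cast; field_simp; ring
  -- §B the formal identity over `ℂ_p`
  set ιO := (PadicComplexInt p).toSubring.subtype with hιO
  set jq : ℚ_[p] →+* ℂ_[p] := algebraMap ℚ_[p] ℂ_[p] with hjq
  have hjq_int : ∀ z : ℤ_[p], jq (z : ℚ_[p]) = ((z : ℚ_[p]) : ℂ_[p]) := fun z ↦ rfl
  set xc : ℂ_[p] := jq xq with hxc
  set wc : ℂ_[p] := jq wq with hwc
  set C₀ : ℂ_[p] := (c₀ : ℂ_[p]) with hC₀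
  set V' : PowerSeries (PowerSeries ℂ_[p]) :=
    PowerSeries.map (PowerSeries.C (R := ℂ_[p])) (PowerSeries.binomialSeries ℂ_[p] xc) *
      PowerSeries.C (PowerSeries.binomialSeries ℂ_[p] wc) with hV'
  set Gc : PowerSeries (PowerSeries ℂ_[p]) := PowerSeries.map (PowerSeries.map ιO) G with hGc
  set G'c : PowerSeries (PowerSeries ℂ_[p]) := PowerSeries.map (PowerSeries.map ιO) G' with hG'c
  set H : PowerSeries (PowerSeries ℂ_[p]) := G'c - PowerSeries.C (PowerSeries.C C₀) * V' * Gc with hH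
  -- restriction of the candidate along ANY monomial line `(c₁, c₂)`
  have hb0 : ∀ c : ℤ_[p], PowerSeries.constantCoeff ((IntSeries.binomPow c - 1).map ιO) = 0 := fun c ↦ by
    rw [← PowerSeries.coeff_zero_eq_constantCoeff_apply, PowerSeries.coeff_map, PowerSeries.coeff_zero_eq_constantCoeff_apply,
      IntSeries.constantCoeff_binomPow_sub_one, map_zero]
  have hrestrict : ∀ c₁ c₂ : ℤ_[p],
      IntSeries.curveSubst ((IntSeries.binomPow c₁ - 1).map ιO) ((IntSeries.binomPow c₂ - 1).map ιO) H =
        (IntSeries.monomialLine c₁ c₂ G').map ιO -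
          PowerSeries.C C₀ * PowerSeries.binomialSeries ℂ_[p] (xc * jq (c₁ : ℚ_[p]) + wc * jq (c₂ : ℚ_[p])) *
            (IntSeries.monomialLine c₁ c₂ G).map ιO := by
    intro c₁ c₂
    rw [hH, IntSeries.curveSubst_sub, IntSeries.curveSubst_mul (hb0 c₁) (hb0 c₂), IntSeries.curveSubst_mul (hb0 c₁) (hb0 c₂),
      IntSeries.curveSubst_C_C, hV', IntSeries.curveSubst_binomialSeries₂, hG'c, hGc, IntSeries.monomialLine,
      IntSeries.monomialLine, IntSeries.map_curveSubst, IntSeries.map_curveSubst, hjq_int, hjq_int]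
  -- along the supply lines `H` restricts to `0`
  have hzero : ∀ s : ℕ,
      IntSeries.curveSubst ((IntSeries.binomPow (e₁ s) - 1).map ιO) ((IntSeries.binomPow (e₂ s) - 1).map ιO) H = 0 := by
    intro s
    rw [hrestrict, hlines s, map_mul, map_mul, PowerSeries.map_C, sub_eq_zero]
    congr 2
    rw [IntSeries.map_binomPow_eq_binomialSeries]
    congr 1
    rw [← hjq_int, ← hexp s, map_add, map_mul, map_mul]
  have hH0 : H = 0 := by
    refine IntSeries.eq_zero_of_curveSubst_eq_zero H (fun s ↦ (IntSeries.binomPow (e₁ s) - 1).map ιO)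
      (fun s ↦ (IntSeries.binomPow (e₂ s) - 1).map ιO) (fun s ↦ hb0 _) (fun s ↦ hb0 _) (fun s ↦ ?_) (fun s t hst ↦ ?_) hzero
    · rw [PowerSeries.coeff_map, IntSeries.coeff_one_binomPow_sub_one]
      exact (map_ne_zero_iff _ (Subtype.coe_injective.comp IntSeries.padicIntToComplexInt_injective)).mpr (hc₂ s)
    · intro h
      rw [PowerSeries.coeff_map, PowerSeries.coeff_map, PowerSeries.coeff_map, PowerSeries.coeff_map,
        IntSeries.coeff_one_binomPow_sub_one, IntSeries.coeff_one_binomPow_sub_one, IntSeries.coeff_one_binomPow_sub_one,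
        IntSeries.coeff_one_binomPow_sub_one, ← map_mul, ← map_mul, ← map_mul, ← map_mul] at h
      exact hprop s t hst (IntSeries.padicIntToComplexInt_injective (Subtype.coe_injective h))
  -- §C integrality of the exponents from the lines `(1, k+1)`
  have hlinek : ∀ k : ℕ, (IntSeries.monomialLine (1 : ℤ_[p]) ((k + 1 : ℕ) : ℤ_[p]) G').map ιO =
      PowerSeries.C C₀ * PowerSeries.binomialSeries ℂ_[p] (xc + wc * ((k : ℂ_[p]) + 1)) *
        (IntSeries.monomialLine (1 : ℤ_[p]) ((k + 1 : ℕ) : ℤ_[p]) G).map ιO := by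
    intro k
    have h := hrestrict 1 ((k + 1 : ℕ) : ℤ_[p])
    rw [hH0] at h
    have h0 : IntSeries.curveSubst ((IntSeries.binomPow (1 : ℤ_[p]) - 1).map ιO)
        ((IntSeries.binomPow (((k + 1 : ℕ) : ℤ_[p])) - 1).map ιO) (0 : PowerSeries (PowerSeries ℂ_[p])) = 0 := by
      exact IntSeries.curveSubst_zero_right _ _
    rw [h0, eq_comm, sub_eq_zero] at h
    convert h using 3
    rw [hjq]
    push_cast
    simp
  have hC₀0 : C₀ ≠ 0 := by
    rw [hc₀val]
    have hιne : ∀ z : ℂ, z ≠ 0 → (((ι.symm z) : PadicAlgCl p) : ℂ_[p]) ≠ 0 := fun z hz ↦ by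
      rw [PadicComplex.coe_eq, map_ne_zero_iff _ (algebraMap (PadicAlgCl p) ℂ_[p]).injective, map_ne_zero_iff _ ι.symm.injective]
      exact hz
    exact mul_ne_zero (pow_ne_zero _ (mul_ne_zero (hιne _ (div_ne_zero hΩ hΩ')) (div_ne_zero hΩp' hΩp)))
      (pow_ne_zero _ (hιne _ (div_ne_zero hδ hδ')))
  have hintk : ∀ k : ℕ, IntSeries.monomialLine (1 : ℤ_[p]) ((k + 1 : ℕ) : ℤ_[p]) G ≠ 0 →
      ∃ z : ℤ_[p], jq (z : ℚ_[p]) = xc + wc * ((k : ℂ_[p]) + 1) := by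
    intro k hk
    set f := IntSeries.monomialLine (1 : ℤ_[p]) ((k + 1 : ℕ) : ℤ_[p]) G with hf
    set f' := IntSeries.monomialLine (1 : ℤ_[p]) ((k + 1 : ℕ) : ℤ_[p]) G' with hf'
    set y : ℂ_[p] := xc + wc * ((k : ℂ_[p]) + 1) with hy
    set Q : PowerSeries ℂ_[p] := PowerSeries.C C₀ * PowerSeries.binomialSeries ℂ_[p] y with hQ
    have hd : PowerSeries.derivative ℂ_[p] Q =
        PowerSeries.C C₀ * PowerSeries.derivative ℂ_[p] (PowerSeries.binomialSeries ℂ_[p] y) := by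
      rw [hQ, ← PowerSeries.smul_eq_C_mul, (PowerSeries.derivative ℂ_[p]).map_smul, PowerSeries.smul_eq_C_mul]
    have hQode : (1 + PowerSeries.X) * PowerSeries.derivative ℂ_[p] Q = PowerSeries.C y * Q := by
      rw [hd, mul_left_comm, IntSeries.ode_binomialSeries, hQ]
      ring
    have hfi : ∀ n, ‖PowerSeries.coeff n (f.map ιO)‖ ≤ 1 := IntSeries.norm_coeff_map_subtype_le_one f
    have hf'i : ∀ n, ‖PowerSeries.coeff n (f'.map ιO)‖ ≤ 1 := IntSeries.norm_coeff_map_subtype_le_one f'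
    have hfne : f.map ιO ≠ 0 := fun h ↦ hk (IntSeries.map_subtype_injective (p := p) (by simpa using h))
    have hrel : f'.map ιO = Q * f.map ιO := hlinek k
    have hQ0 : Q ≠ 0 := by
      intro h0
      have h1 := congrArg PowerSeries.constantCoeff h0
      rw [hQ, map_mul, PowerSeries.constantCoeff_C, PowerSeries.binomialSeries_constantCoeff, mul_one, map_zero] at h1
      exact hC₀0 h1
    have hf'ne : f'.map ιO ≠ 0 := by rw [hrel]; exact mul_ne_zero hQ0 hfne
    obtain ⟨z, hz⟩ := exists_padicInt_eq_of_binomial_twist_of_ne_zero (p := p) PadicComplex.exists_norm_lt_one_lt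
      hQode hrel hfi hf'i hfne hf'ne
    exact ⟨z, hz⟩
  -- two consecutive good `k`
  obtain ⟨Nb, hNb⟩ := (finite_setOf_monomialLine_one_eq_zero (p := p) hG0).bddAbove
  have hgood : ∀ k, Nb < k → IntSeries.monomialLine (1 : ℤ_[p]) ((k + 1 : ℕ) : ℤ_[p]) G ≠ 0 :=
    fun k hk h ↦ absurd (hNb h) (not_le.2 hk)
  obtain ⟨z₁, hz₁⟩ := hintk (Nb + 1) (hgood _ (by omega))
  obtain ⟨z₂, hz₂⟩ := hintk (Nb + 2) (hgood _ (by omega))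
  have hjq_inj : Function.Injective jq := (algebraMap ℚ_[p] ℂ_[p]).injective
  -- `w = z₂ − z₁`, `x = z₁ − (Nb+2)(z₂ − z₁)`
  set w : ℤ_[p] := z₂ - z₁ with hwdef
  set x : ℤ_[p] := z₁ - (((Nb + 1 : ℕ) : ℤ_[p]) + 1) * w with hxdef
  have hwq' : jq (w : ℚ_[p]) = wc := by
    rw [hwdef, PadicInt.coe_sub, map_sub, hz₁, hz₂]
    push_cast
    ring
  have hxq' : jq (x : ℚ_[p]) = xc := by
    rw [hxdef, PadicInt.coe_sub, PadicInt.coe_mul, PadicInt.coe_add, PadicInt.coe_one, PadicInt.coe_natCast, map_sub,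
      map_mul, map_add, map_one, map_natCast, hwq', hz₁]
    ring
  have hwq_eq : (w : ℚ_[p]) = wq := hjq_inj (by rw [hwq', hwc])
  have hxq_eq : (x : ℚ_[p]) = xq := hjq_inj (by rw [hxq', hxc])
  -- §D the integral unit and the identity in `𝒪_{ℂ_p}⟦T₁⟧⟦T₂⟧`
  set V : PowerSeries (PowerSeries (PadicComplexInt p)) :=
    PowerSeries.map (PowerSeries.C (R := PadicComplexInt p)) (IntSeries.binomPow x) * PowerSeries.C (IntSeries.binomPow w) with hVdef
  have hcomm : (PowerSeries.map ιO).comp (PowerSeries.C (R := PadicComplexInt p)) = (PowerSeries.C (R := ℂ_[p])).comp ιO :=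
    RingHom.ext fun r ↦ PowerSeries.map_C ιO r
  have hVmap : PowerSeries.map (PowerSeries.map ιO) V = V' := by
    have hmm : PowerSeries.map (PowerSeries.map ιO) (PowerSeries.map (PowerSeries.C (R := PadicComplexInt p)) (IntSeries.binomPow x)) =
        PowerSeries.map (PowerSeries.C (R := ℂ_[p])) (PowerSeries.map ιO (IntSeries.binomPow x)) := by
      rw [← RingHom.comp_apply (PowerSeries.map (PowerSeries.map ιO)), ← PowerSeries.map_comp, hcomm, PowerSeries.map_comp,
        RingHom.comp_apply]
    rw [hVdef, hV', map_mul, PowerSeries.map_C, hmm,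
      IntSeries.map_binomPow_eq_binomialSeries, IntSeries.map_binomPow_eq_binomialSeries, ← hjq_int, ← hjq_int, hxq', hwq']
  have hmapinj : Function.Injective (PowerSeries.map (PowerSeries.map ιO) :
      PowerSeries (PowerSeries (PadicComplexInt p)) → PowerSeries (PowerSeries ℂ_[p])) :=
    PowerSeries.map_injective _ (PowerSeries.map_injective _ Subtype.coe_injective)
  refine ⟨c₀, x, w, hc₀unit, hc₀val, hmapinj ?_⟩
  have hH' : G'c = PowerSeries.C (PowerSeries.C C₀) * V' * Gc := sub_eq_zero.1 (by rw [← hH]; exact hH0)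
  have hιOc : ιO c₀ = C₀ := rfl
  rw [map_mul, map_mul, PowerSeries.map_C, PowerSeries.map_C, hιOc, hVmap, ← hGc, ← hG'c, hH']

/-- **IDEAL RIGIDITY**: two frames of one branch at two period triples generate the SAME ideal of `𝒪_{ℂ_p}⟦T₁⟧⟦T₂⟧`.
[cite: deShalit1987, II.4.12 Remarks (iii)–(iv) (p. 66–67)] -/
theorem span_eq_span_of_isKatzMeasure₂ (hK : IsImaginaryQuadratic K)
    {ι : PadicAlgCl p ≃+* ℂ} {v vbar : HeightOneSpectrum (𝓞 K)}
    (hv : ((p : ℕ) : 𝓞 K) ∈ v.asIdeal) (hvbar : ((p : ℕ) : 𝓞 K) ∈ vbar.asIdeal) (hne : vbar ≠ v)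
    (hι : ∀ (w : InfinitePlace K) (d : 𝓞 K), d ∈ v.asIdeal ↔ ‖ι.symm (w.embedding (d : K))‖ < 1)
    {S : Finset (HeightOneSpectrum (𝓞 K))}
    {η : HeckeCharacter K} {w₀ : ℕ} (hw₀ : 0 < w₀) (hη : η.HasInfinityType (fun _ ↦ (w₀ : ℤ)) (fun _ ↦ 0))
    {lam : HeckeCharacter K} {a b : ℕ} (hba : b ≤ a)
    (hlam : lam.HasInfinityType (fun _ ↦ -(a : ℤ)) (fun _ ↦ (b : ℤ)))
    (hlamu : ∀ w : HeightOneSpectrum (𝓞 K), w ∉ S → w ≠ vbar → lam.IsUnramifiedAt w)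
    {κ₁ κ₂ : ZpExtension K p} {γ₁ γ₂ : absoluteGaloisGroup K}
    (hpair : ZpExtension.IsTopGeneratorPair κ₁ κ₂ γ₁ γ₂)
    {Ω δ Ω' δ' : ℂ} {Ωp Ωp' : ℂ_[p]} {G G' : PowerSeries (PowerSeries (PadicComplexInt p))}
    (hG : IsKatzMeasure₂ ι v vbar S κ₁ κ₂ γ₁ γ₂ lam Ω δ Ωp G)
    (hG' : IsKatzMeasure₂ ι v vbar S κ₁ κ₂ γ₁ γ₂ lam Ω' δ' Ωp' G')
    (hΩ : Ω ≠ 0) (hδ : δ ≠ 0) (hΩp : Ωp ≠ 0) (hΩ' : Ω' ≠ 0) (hδ' : δ' ≠ 0) (hΩp' : Ωp' ≠ 0)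
    (hG0 : G ≠ 0) :
    Ideal.span {G'} = Ideal.span {G} := by
  obtain ⟨c₀, x, w, hc₀, -, hGG⟩ := exists_eq_unit_binomPow₂_mul hK hv hvbar hne hι hw₀ hη hba hlam hlamu hpair hG hG' hΩ hδ
    hΩp hΩ' hδ' hΩp' hG0
  have hU : IsUnit (PowerSeries.C (PowerSeries.C c₀) *
      (PowerSeries.map (PowerSeries.C (R := PadicComplexInt p)) (IntSeries.binomPow x) * PowerSeries.C (IntSeries.binomPow w))) :=
    ((hc₀.map PowerSeries.C).map PowerSeries.C).mul
      (((IntSeries.isUnit_binomPow x).map _).mul ((IntSeries.isUnit_binomPow w).map _))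
  rw [hGG]
  exact Ideal.span_singleton_mul_left_unit hU G

/-- **The main-conjecture clause is period-independent**: for every ideal `I` of `𝒪_{ℂ_p}⟦T₁⟧⟦T₂⟧` (e.g. a mapped characteristic
ideal), `I = (G) ↔ I = (G')`. [cite: deShalit1987, II.4.12 Remarks (iii)–(iv) (p. 66–67)] -/
theorem charIdeal_clause_transport (hK : IsImaginaryQuadratic K)
    {ι : PadicAlgCl p ≃+* ℂ} {v vbar : HeightOneSpectrum (𝓞 K)}
    (hv : ((p : ℕ) : 𝓞 K) ∈ v.asIdeal) (hvbar : ((p : ℕ) : 𝓞 K) ∈ vbar.asIdeal) (hne : vbar ≠ v)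
    (hι : ∀ (w : InfinitePlace K) (d : 𝓞 K), d ∈ v.asIdeal ↔ ‖ι.symm (w.embedding (d : K))‖ < 1)
    {S : Finset (HeightOneSpectrum (𝓞 K))}
    {η : HeckeCharacter K} {w₀ : ℕ} (hw₀ : 0 < w₀) (hη : η.HasInfinityType (fun _ ↦ (w₀ : ℤ)) (fun _ ↦ 0))
    {lam : HeckeCharacter K} {a b : ℕ} (hba : b ≤ a)
    (hlam : lam.HasInfinityType (fun _ ↦ -(a : ℤ)) (fun _ ↦ (b : ℤ)))
    (hlamu : ∀ w : HeightOneSpectrum (𝓞 K), w ∉ S → w ≠ vbar → lam.IsUnramifiedAt w)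
    {κ₁ κ₂ : ZpExtension K p} {γ₁ γ₂ : absoluteGaloisGroup K}
    (hpair : ZpExtension.IsTopGeneratorPair κ₁ κ₂ γ₁ γ₂)
    {Ω δ Ω' δ' : ℂ} {Ωp Ωp' : ℂ_[p]} {G G' : PowerSeries (PowerSeries (PadicComplexInt p))}
    (hG : IsKatzMeasure₂ ι v vbar S κ₁ κ₂ γ₁ γ₂ lam Ω δ Ωp G)
    (hG' : IsKatzMeasure₂ ι v vbar S κ₁ κ₂ γ₁ γ₂ lam Ω' δ' Ωp' G')
    (hΩ : Ω ≠ 0) (hδ : δ ≠ 0) (hΩp : Ωp ≠ 0) (hΩ' : Ω' ≠ 0) (hδ' : δ' ≠ 0) (hΩp' : Ωp' ≠ 0)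
    (hG0 : G ≠ 0) (I : Ideal (PowerSeries (PowerSeries (PadicComplexInt p)))) :
    I = Ideal.span {G} ↔ I = Ideal.span {G'} := by
  rw [span_eq_span_of_isKatzMeasure₂ hK hv hvbar hne hι hw₀ hη hba hlam hlamu hpair hG hG' hΩ hδ hΩp hΩ' hδ' hΩp' hG0]

end Summit.BirchSwinnertonDyer.BirchSwinnertonDyer.Theorems.PrintCf2.KatzPeriodRigidity

end
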